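import Literature.MathematicalPhysics.QuantumFieldTheory.OSContinuationPieces
import HarnessLib

/-!
# One continuation step of OS II with spatial labels: vectors, piece functions, real points

Topic `Literature/MathematicalPhysics/QuantumFieldTheory`; support file (all proved; three
`Prop`-valued structures bundling hypotheses and three label maps; no named facts) for the
discharge of (A1) `OS1975_exists_timeContinuation`. This is `OSContinuationPieces` **with the
spatial variables restored as labels**. Osterwalder–Schrader II (Comm. Math. Phys. 42 (1975)),
Ch. V.2, p. 294: *"In the rest of this chapter the spatial variables will always play the role of
parameters and we therefore drop them completely in our formulas"* — but they cannot be dropped from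
the *bookkeeping*: in the Gram identity (5.17)/(5.4),

  `(Ψₙ(x', ξ' | x⃗', ξ⃗'), e^{-τH} Ψₘ(x, ξ | x⃗, ξ⃗)) = S_{n+m-1}(−ξ̃', x' + x + τ, ξ | ϑ(x⃗', ξ⃗'), x⃗, ξ⃗)`,

the vector on the left carries the spatial data of the *reflected, reversed* left part of the
configuration and the vector on the right that of the right part, so the induction (A_N) ⇒ (P_N) ⇒
(A_{N+1}) for the function attached to one spatial configuration uses the functions attached to the
*doubled* configurations `ϑ(left) ∘ left` and `ϑ(right) ∘ right` of its two parts at every split. The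
label-free `OSContinuationPieces` is the special case of a one-point label type. Here:

* labels: a function of `k` complex time gaps carries the labels `c : Fin (k+1) → E` of its `k + 1`
  points (`E` arbitrary: spatial positions in OS), a vector with `n` gaps the labels
  `a : Fin (n+1) → E` of its `n + 1` points; `posRevLeft c p = (c_p, …, c_0)`,
  `posRight c p = (c_{p+1}, …, c_k)` are the labels of the two parts at the split `p`, and
  `dblPos a = (a_m, …, a_0, a_0, …, a_m)` those of the doubled configuration
  (`posRevLeft (dblPos a) m = a`, `posRight (dblPos a) m = a`);
* `IsOSLabelledVectors T Φ` — the real-point vectors `Φ n a x ξ` are shifted by the semigroup;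
* `IsOSLabelSet good` — a class of labels closed under `c ↦ dblPos (posRevLeft c p)`,
  `c ↦ dblPos (posRight c p)` (in OS: all positions in a fixed ball, on which (4.5) is uniform);
* `IsOSLabelledLevel N good S Φ` — level data: `S k c` holomorphic on the argument region of
  `c_k^{(N+1)}` for good `c`, and the labelled block Gram identities at positive real points
  `⟪Φ p (posRevLeft c p) x' (Z_{p-1},…,Z_0), Φ (k-1-p) (posRight c p) x (Z_{p+1},…)⟫ = S k c Z`;
* `IsOSLabelledLevel.exists_vectors` — (P_N): holomorphic vectors `Ψ m a x` on the regions of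
  `d_m^{(N+1)}` with `‖Ψ m a x ζ‖² = Re S_{2m+1}(dblPos a)(θζ, 2x, ζ)` and the complex shift;
* `exists_pieceFunL`, `pieceFunL_ofReal` — the piece functions
  `F Z = ⟪Ψ p (posRevLeft c p) x' (θ left), T τ (Ψ (k-1-p) (posRight c p) x right)⟫` on the
  argument regions of the pieces, agreeing with `S k c` at the positive real points.

## References

* K. Osterwalder, R. Schrader, *Axioms for Euclidean Green's functions II*, Comm. Math. Phys. 42
  (1975) 281–305, Ch. V (5.2), (5.4), Ch. V.2 pp. 294–295, (5.15)–(5.21). [OsterwalderSchraderCMP1975]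
-/

noncomputable section

open Metric Set Filter Complex
open scoped Topology ComplexConjugate InnerProductSpace

namespace Literature.MathematicalPhysics.QuantumFieldTheory.OSEnvelope

open Literature.Analysis.Complex Literature.MathematicalPhysics.QuantumFieldTheory

variable {E : Type*} {H : Type*} [NormedAddCommGroup H] [InnerProductSpace ℂ H]

/-! ### Labels of the blocks and of the doubled configuration -/

section Labels

variable {k m : ℕ}

/-- **Labels of the reflected left part** at the split `p`: `(c_p, c_{p-1}, …, c_0)`. [cite: OsterwalderSchraderCMP1975, Ch. V (5.2), (5.4)] -/
def posRevLeft (c : Fin (k + 1) → E) (p : Fin k) : Fin (p + 1) → E :=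
  fun i => c ⟨p - i, by omega⟩

/-- **Labels of the right part** at the split `p`: `(c_{p+1}, …, c_k)`. [cite: OsterwalderSchraderCMP1975, Ch. V (5.2), (5.4)] -/
def posRight (c : Fin (k + 1) → E) (p : Fin k) : Fin (k - 1 - p + 1) → E :=
  fun i => c ⟨p + 1 + i, by have := i.2; have := p.2; omega⟩

/-- **Labels of the doubled configuration** `ϑ(a) ∘ a = (a_m, …, a_0, a_0, …, a_m)` (the
configuration whose Schwinger function is the squared norm of the vector labelled `a`, (5.17) with
`n = m`). [cite: OsterwalderSchraderCMP1975, Ch. V.2 (5.17), (5.21)] -/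
def dblPos (a : Fin (m + 1) → E) : Fin (m + 1 + m + 1) → E :=
  fun i => if h : (i : ℕ) ≤ m then a ⟨m - i, by omega⟩ else a ⟨i - (m + 1), by have := i.2; omega⟩

/-- Entries of `posRevLeft`. [folklore] -/
@[simp] theorem posRevLeft_apply (c : Fin (k + 1) → E) (p : Fin k) (i : Fin (p + 1)) :
    posRevLeft c p i = c ⟨p - i, by omega⟩ := rfl

/-- Entries of `posRight`. [folklore] -/
@[simp] theorem posRight_apply (c : Fin (k + 1) → E) (p : Fin k) (i : Fin (k - 1 - p + 1)) :
    posRight c p i = c ⟨p + 1 + i, by have := i.2; have := p.2; omega⟩ := rfl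

/-- Entries of `dblPos` in the left half. [folklore] -/
theorem dblPos_apply_of_le (a : Fin (m + 1) → E) {i : Fin (m + 1 + m + 1)} (h : (i : ℕ) ≤ m) :
    dblPos a i = a ⟨m - i, by omega⟩ := dif_pos h

/-- Entries of `dblPos` in the right half. [folklore] -/
theorem dblPos_apply_of_lt (a : Fin (m + 1) → E) {i : Fin (m + 1 + m + 1)} (h : m < (i : ℕ)) :
    dblPos a i = a ⟨i - (m + 1), by have := i.2; omega⟩ := dif_neg (not_le.2 h)

/-- **The reflected left part of the doubled configuration is the original one.** [folklore] -/
theorem posRevLeft_dblPos (a : Fin (m + 1) → E) : posRevLeft (dblPos a) (midPos m m) = a := by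
  funext i
  have hi : (i : ℕ) ≤ m := by have := i.2; simp only [midPos] at this; omega
  rw [posRevLeft_apply, dblPos_apply_of_le a (by simp only [midPos]; omega)]
  congr 1
  ext
  simp only [midPos]
  omega

/-- **The right part of the doubled configuration is the original one** (entrywise, along the
index identification `m + 1 + m - 1 - m + 1 = m + 1`). [folklore] -/
theorem posRight_dblPos (a : Fin (m + 1) → E) (i : Fin (m + 1 + m - 1 - (midPos m m : ℕ) + 1)) :
    posRight (dblPos a) (midPos m m) i = a ⟨i, by have := i.2; simp only [midPos] at this; omega⟩ := by
  rw [posRight_apply, dblPos_apply_of_lt a (by simp only [midPos]; omega)]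
  congr 1
  ext
  simp only [midPos]
  omega

omit [NormedAddCommGroup H] [InnerProductSpace ℂ H] in
/-- Transport of `Φ n a x v` along `n = n'` with entrywise agreement of labels and entries. [folklore] -/
theorem vecL_congr (Φ : (n : ℕ) → (Fin (n + 1) → E) → ℝ → (Fin n → ℝ) → H) {n n' : ℕ} (h : n = n')
    (a : Fin (n + 1) → E) (a' : Fin (n' + 1) → E) (ha : ∀ i : Fin (n + 1), a i = a' (Fin.cast (by rw [h]) i))
    (x : ℝ) (u : Fin n → ℝ) (v : Fin n' → ℝ) (huv : ∀ i : Fin n, u i = v (Fin.cast h i)) :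
    Φ n a x u = Φ n' a' x v := by
  subst h
  obtain rfl : a = a' := funext ha
  obtain rfl : u = v := funext huv
  rfl

end Labels

/-! ### The hypotheses -/

/-- **The labelled real-point vectors** `Φ n a x ξ = Ψ_{n+1}(x, ξ | a)` (`n + 1` points with labels
`a`, first time `x > 0`, time gaps `ξ ∈ ℝ₊ⁿ`) are shifted by the semigroup:
`e^{-tH} Ψ(x, ξ | a) = Ψ(x + t, ξ | a)`. [cite: OsterwalderSchraderCMP1975, Ch. V (5.3), Ch. V.2 (5.16)–(5.17)] -/
structure IsOSLabelledVectors (T : ℂ → H →L[ℂ] H)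
    (Φ : (n : ℕ) → (Fin (n + 1) → E) → ℝ → (Fin n → ℝ) → H) : Prop where
  shift : ∀ (n : ℕ) (a : Fin (n + 1) → E) (x t : ℝ), 0 < x → 0 < t → ∀ ξ : Fin n → ℝ, (∀ i, 0 < ξ i) →
    T t (Φ n a x ξ) = Φ n a (x + t) ξ

/-- **A class of labels closed under the doubling of the two parts at every split** (the labels met
along the induction started at a label of the class stay in the class; in OS: the configurations
with all spatial positions in a fixed ball). [cite: OsterwalderSchraderCMP1975, Ch. V.2 (5.15)–(5.17)] -/
structure IsOSLabelSet (good : (k : ℕ) → (Fin (k + 1) → E) → Prop) : Prop where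
  left : ∀ (k : ℕ) (c : Fin (k + 1) → E) (p : Fin k), good k c → good (p + 1 + p) (dblPos (posRevLeft c p))
  right : ∀ (k : ℕ) (c : Fin (k + 1) → E) (p : Fin k), good k c →
    good (k - 1 - p + 1 + (k - 1 - p)) (dblPos (posRight c p))

/-- **Labelled level data (A_N) with (5.17) at the real points**: for every good label `c`,
`S k c` is holomorphic on the argument region of `c_k^{(N+1)}`, and, for all labels, at positive
real `Z` with `x' + x = Z_p`,
`⟪Φ p (c_p,…,c_0) x' (Z_{p-1},…,Z_0), Φ (k-1-p) (c_{p+1},…,c_k) x (Z_{p+1},…,Z_{k-1})⟫ = S k c Z`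
(the pointwise form of (5.2)/(5.4) at `τ = 0`). [cite: OsterwalderSchraderCMP1975, Ch. V (5.2), (5.4), Ch. V.2 (5.15)–(5.17)] -/
structure IsOSLabelledLevel (N : ℕ) (good : (k : ℕ) → (Fin (k + 1) → E) → Prop)
    (S : (k : ℕ) → (Fin (k + 1) → E) → (Fin k → ℂ) → ℂ)
    (Φ : (n : ℕ) → (Fin (n + 1) → E) → ℝ → (Fin n → ℝ) → H) : Prop where
  holo : ∀ (k : ℕ) (c : Fin (k + 1) → E), good k c → DifferentiableOn ℂ (S k c) (argRegion (osBaseC (N + 1) k))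
  gram : ∀ (k : ℕ) (c : Fin (k + 1) → E) (p : Fin k) (ρ : Fin k → ℝ), (∀ i, 0 < ρ i) →
    ∀ x' x : ℝ, 0 < x' → 0 < x → x' + x = ρ p →
      ⟪Φ p (posRevLeft c p) x' (blockRevLeft ρ p), Φ (k - 1 - p) (posRight c p) x (blockRight ρ p)⟫_ℂ =
        S k c (fun i => (ρ i : ℂ))

/-! ### (P_N): the vectors on the regions of `d^{(N+1)}`, with the complex shift -/

section Vectors

variable [CompleteSpace H] {T : ℂ → H →L[ℂ] H} {CT : ℝ}
  {Φ : (n : ℕ) → (Fin (n + 1) → E) → ℝ → (Fin n → ℝ) → H}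
  {N : ℕ} {good : (k : ℕ) → (Fin (k + 1) → E) → Prop} {S : (k : ℕ) → (Fin (k + 1) → E) → (Fin k → ℂ) → ℂ}

omit [CompleteSpace H] in
/-- The Gram hypothesis of `exists_osVectors` for the label `a`, from the block-form Gram
identities at the label `dblPos a`. [cite: OsterwalderSchraderCMP1975, Ch. V.2 (5.17)] -/
theorem IsOSLabelledLevel.gram_diag (hL : IsOSLabelledLevel N good S Φ) (m : ℕ) (a : Fin (m + 1) → E)
    {x : ℝ} (hx : 0 < x) (η η' : Fin m → ℝ) (hη : ∀ i, 0 < η i) (hη' : ∀ i, 0 < η' i) :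
    ⟪Φ m a x η', Φ m a x η⟫_ℂ =
      S (m + 1 + m) (dblPos a) (cDiagEmbed (fun i => (η' i : ℂ)) ((2 * x : ℝ) : ℂ) (fun i => (η i : ℂ))) := by
  set ρ : Fin (m + 1 + m) → ℝ := cPlace η' (2 * x) η with hρ
  have hρpos : ∀ i, 0 < ρ i := by
    intro i
    rcases lt_trichotomy (i : ℕ) m with h | h | h
    · rw [hρ, cPlace_apply_lt _ _ _ h]; exact hη' _
    · rw [hρ, cPlace_apply_mid _ _ _ h]; positivity
    · rw [hρ, cPlace_apply_gt _ _ _ h]; exact hη _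
  have h := hL.gram (m + 1 + m) (dblPos a) (midPos m m) ρ hρpos x x hx hx (by rw [hρ, cPlace_midPos]; ring)
  have hleft : blockRevLeft ρ (midPos m m) = η' := blockRevLeft_cPlace _ _ _
  have hsize : m + 1 + m - 1 - ((midPos m m : Fin (m + 1 + m)) : ℕ) = m := by simp
  have hright : Φ (m + 1 + m - 1 - ((midPos m m : Fin (m + 1 + m)) : ℕ)) (posRight (dblPos a) (midPos m m)) x
      (blockRight ρ (midPos m m)) = Φ m a x η :=
    vecL_congr Φ hsize _ _ (fun i => by rw [posRight_dblPos]; rfl) x _ _ fun i => by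
      rw [hρ, blockRight_cPlace]; rfl
  rw [hleft, posRevLeft_dblPos, hright] at h
  have h' : ⟪Φ m a x η', Φ m a x η⟫_ℂ = S (m + 1 + m) (dblPos a) (fun i => (ρ i : ℂ)) := h
  rw [h', cDiagEmbed_eq_cPlace, ← cPlace_map (fun r : ℝ => (r : ℂ))]

/-- **(P_N) for all `m`, all labels `a` with good doubled label, `x > 0`, with the complex
shift.** Holomorphic vectors `Ψ m a x` on the argument regions of `d_m^{(N+1)}`, extending
`Φ m a x` at the positive real points, with `‖Ψ m a x ζ‖² = Re S_{2m+1}(dblPos a)(θζ, 2x, ζ)`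
((5.21)) and `T t (Ψ m a x ζ) = Ψ m a (x + t) ζ`. [cite: OsterwalderSchraderCMP1975, Ch. V.2 (5.16)–(5.21)] -/
theorem IsOSLabelledLevel.exists_vectors (hL : IsOSLabelledLevel N good S Φ) (hΦ : IsOSLabelledVectors T Φ) :
    ∃ Ψ : (m : ℕ) → (Fin (m + 1) → E) → ℝ → (Fin m → ℂ) → H,
      ∀ (m : ℕ) (a : Fin (m + 1) → E), good (m + 1 + m) (dblPos a) → ∀ x : ℝ, 0 < x →
      DifferentiableOn ℂ (Ψ m a x) (argRegion (osBaseD (N + 1) m)) ∧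
      (∀ η : Fin m → ℝ, (∀ i, 0 < η i) → Ψ m a x (fun i => (η i : ℂ)) = Φ m a x η) ∧
      (∀ ζ ∈ argRegion (osBaseD (N + 1) m),
        ‖Ψ m a x ζ‖ ^ 2 = (S (m + 1 + m) (dblPos a) (cDiagEmbed (star ζ) ((2 * x : ℝ) : ℂ) ζ)).re) ∧
      (∀ t : ℝ, 0 < t → ∀ ζ ∈ argRegion (osBaseD (N + 1) m), T t (Ψ m a x ζ) = Ψ m a (x + t) ζ) := by
  -- vectors for each `m`, `a`, `x`
  have hex : ∀ (m : ℕ) (a : Fin (m + 1) → E) (x : ℝ), good (m + 1 + m) (dblPos a) → 0 < x →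
      ∃ Ψ : (Fin m → ℂ) → H,
      DifferentiableOn ℂ Ψ (argRegion (osBaseD (N + 1) m)) ∧
      (∀ η : Fin m → ℝ, (∀ i, 0 < η i) → Ψ (fun i => (η i : ℂ)) = Φ m a x η) ∧
      (∀ ζ ∈ argRegion (osBaseD (N + 1) m),
        ‖Ψ ζ‖ ^ 2 = (S (m + 1 + m) (dblPos a) (cDiagEmbed (star ζ) ((2 * x : ℝ) : ℂ) ζ)).re) := by
    intro m a x ha hx
    obtain ⟨Ψ, h1, h2, -, h4, -⟩ := exists_osVectors (hL.holo (m + 1 + m) _ ha) hx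
      (fun η η' hη hη' => hL.gram_diag m a hx η η' hη hη')
    exact ⟨Ψ, h1, h2, h4⟩
  choose! Ψ hhol hreal hnorm using hex
  refine ⟨Ψ, fun m a ha x hx => ⟨hhol m a x ha hx, hreal m a x ha hx, hnorm m a x ha hx, fun t ht => ?_⟩⟩
  -- the complex shift from the real points
  have hU : IsOpen (argRegion (osBaseD (N + 1) m)) := isOpen_argRegion (isOpen_osBaseD_succ N m)
  have hUc : IsPreconnected (argRegion (osBaseD (N + 1) m)) :=
    isPreconnected_argRegion (convex_osBaseD _ _) (osBaseD_subset_cube _ _)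
  have h1 : (fun _ : Fin m => ((1 : ℝ) : ℂ)) ∈ argRegion (osBaseD (N + 1) m) :=
    ofReal_mem_argRegion (isOSBaseFamily_osBase.zero_mem_D (N + 1) m) fun _ => one_pos
  refine clm_apply_eq_of_eq_on_reals hU hUc h1 (hhol m a x ha hx) (hhol m a (x + t) ha (by linarith)) (T t) ?_
  intro η hη
  have hηpos : ∀ i, 0 < η i := pos_of_ofReal_mem_argRegion hη
  rw [hreal m a x ha hx η hηpos, hreal m a (x + t) ha (by linarith) η hηpos]
  exact hΦ.shift m a x t hx ht η hηpos

end Vectors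

/-! ### The piece functions of (A_{N+1}) -/

section Pieces

variable [CompleteSpace H] {T : ℂ → H →L[ℂ] H} {CT : ℝ} {N : ℕ}

/-- **The labelled piece function at position `p`** (OS II p. 294 with (5.4)): given vectors with
their complex shifts for the labels of the two parts of `c` at `p`, there is `F` holomorphic on the
argument region of `osPiece (N+1) k p` with
`F Z = ⟪Ψ p (posRevLeft c p) x' (θ left), T τ (Ψ (k-1-p) (posRight c p) x right)⟫` for every split
`x' + x + τ = Z_p`, `x', x > 0`, `Re τ ≥ 0`. [cite: OsterwalderSchraderCMP1975, Ch. V (5.4), Ch. V.2 p. 294] -/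
theorem exists_pieceFunL (hT : IsOSSemigroup T CT) {G : (m : ℕ) → (Fin (m + 1) → E) → Prop}
    {Ψ : (m : ℕ) → (Fin (m + 1) → E) → ℝ → (Fin m → ℂ) → H}
    (hhol : ∀ (m : ℕ) (a : Fin (m + 1) → E), G m a → ∀ x : ℝ, 0 < x →
      DifferentiableOn ℂ (Ψ m a x) (argRegion (osBaseD (N + 1) m)))
    (hshift : ∀ (m : ℕ) (a : Fin (m + 1) → E), G m a → ∀ x : ℝ, 0 < x → ∀ t : ℝ, 0 < t →
      ∀ ζ ∈ argRegion (osBaseD (N + 1) m), T t (Ψ m a x ζ) = Ψ m a (x + t) ζ)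
    (k : ℕ) (c : Fin (k + 1) → E) (p : Fin k) (hl : G p (posRevLeft c p)) (hr : G (k - 1 - p) (posRight c p)) :
    ∃ F : (Fin k → ℂ) → ℂ, DifferentiableOn ℂ F (argRegion (osPiece (N + 1) k p)) ∧
      ∀ Z ∈ argRegion (osPiece (N + 1) k p), ∀ (x' x : ℝ) (τ : ℂ), 0 < x' → 0 < x → 0 ≤ τ.re →
        (x' : ℂ) + x + τ = Z p →
          F Z = ⟪Ψ p (posRevLeft c p) x' (star (blockRevLeft Z p)),
            T τ (Ψ (k - 1 - p) (posRight c p) x (blockRight Z p))⟫_ℂ := by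
  have hU₁ : IsOpen (argRegion (osBaseD (N + 1) p)) := isOpen_argRegion (isOpen_osBaseD_succ N _)
  have hU₂ : IsOpen (argRegion (osBaseD (N + 1) (k - 1 - p))) :=
    isOpen_argRegion (isOpen_osBaseD_succ N _)
  obtain ⟨G', hGd, hGsplit⟩ := exists_generatingFunction (m₁ := p) (m₂ := k - 1 - p)
    (Ψ₁ := Ψ p (posRevLeft c p)) (Ψ₂ := Ψ (k - 1 - p) (posRight c p)) hT.weakHolo ⟨CT, hT.norm_le⟩
    hT.law hT.symm hU₁ hU₂ (fun x hx => hhol _ _ hl x hx) (fun x hx => hhol _ _ hr x hx)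
    (fun x t hx ht w hw => hshift _ _ hl x hx t ht w hw) (fun x t hx ht z hz => hshift _ _ hr x hx t ht z hz)
  refine ⟨fun Z => G' (blockRevLeft Z p, Z p, blockRight Z p), ?_, ?_⟩
  · refine hGd.comp (differentiable_blocks p).differentiableOn fun Z hZ => ?_
    exact ⟨star_blockRevLeft_mem_argRegion hZ.1 p hZ.2.1, hZ.1 p,
      blockRight_mem_argRegion hZ.1 p hZ.2.2.2⟩
  · intro Z hZ x' x τ hx' hx hτ hsum
    exact hGsplit _ _ _ (star_blockRevLeft_mem_argRegion hZ.1 p hZ.2.1)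
      (blockRight_mem_argRegion hZ.1 p hZ.2.2.2) x' x τ hx' hx hτ hsum

omit [CompleteSpace H] in
/-- **The labelled piece functions agree with `S k c` at the positive real points** (split
`x' = x = Z_p/2`, `τ = 0`, `T 0 = 1`, `Ψ = Φ` at real points, and the labelled (5.17)). [cite: OsterwalderSchraderCMP1975, Ch. V.2 p. 294, (5.17)] -/
theorem pieceFunL_ofReal {good : (k : ℕ) → (Fin (k + 1) → E) → Prop}
    {S : (k : ℕ) → (Fin (k + 1) → E) → (Fin k → ℂ) → ℂ}
    {Φ : (n : ℕ) → (Fin (n + 1) → E) → ℝ → (Fin n → ℝ) → H}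
    (hT : IsOSSemigroup T CT) (hL : IsOSLabelledLevel N good S Φ) {G : (m : ℕ) → (Fin (m + 1) → E) → Prop}
    {Ψ : (m : ℕ) → (Fin (m + 1) → E) → ℝ → (Fin m → ℂ) → H}
    (hreal : ∀ (m : ℕ) (a : Fin (m + 1) → E), G m a → ∀ x : ℝ, 0 < x → ∀ η : Fin m → ℝ, (∀ i, 0 < η i) →
      Ψ m a x (fun i => (η i : ℂ)) = Φ m a x η)
    {k : ℕ} {c : Fin (k + 1) → E} {p : Fin k} (hl : G p (posRevLeft c p)) (hr : G (k - 1 - p) (posRight c p))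
    {F : (Fin k → ℂ) → ℂ}
    (hF : ∀ Z ∈ argRegion (osPiece (N + 1) k p), ∀ (x' x : ℝ) (τ : ℂ), 0 < x' → 0 < x → 0 ≤ τ.re →
      (x' : ℂ) + x + τ = Z p →
        F Z = ⟪Ψ p (posRevLeft c p) x' (star (blockRevLeft Z p)),
          T τ (Ψ (k - 1 - p) (posRight c p) x (blockRight Z p))⟫_ℂ)
    {ρ : Fin k → ℝ} (hρ : ∀ i, 0 < ρ i) :
    F (fun i => (ρ i : ℂ)) = S k c (fun i => (ρ i : ℂ)) := by
  have hmem : (fun i => (ρ i : ℂ)) ∈ argRegion (osPiece (N + 1) k p) :=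
    ofReal_mem_argRegion (zero_mem_osPiece _ _ p) hρ
  have hx : 0 < ρ p / 2 := by have := hρ p; positivity
  rw [hF _ hmem (ρ p / 2) (ρ p / 2) 0 hx hx (by simp) (by push_cast; ring), hT.zero,
    one_apply_eq_self]
  -- real blocks
  have hL1 : star (blockRevLeft (fun i => (ρ i : ℂ)) p) = fun i => ((blockRevLeft ρ p i : ℝ) : ℂ) := by
    funext i; simp [Pi.star_apply, Complex.conj_ofReal]
  have hR1 : blockRight (fun i => (ρ i : ℂ)) p = fun i => ((blockRight ρ p i : ℝ) : ℂ) := rfl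
  rw [hL1, hR1, hreal p _ hl (ρ p / 2) hx (blockRevLeft ρ p) (fun i => hρ _),
    hreal (k - 1 - p) _ hr (ρ p / 2) hx (blockRight ρ p) (fun i => hρ _)]
  exact hL.gram k c p ρ hρ _ _ hx hx (by ring)

end Pieces

end Literature.MathematicalPhysics.QuantumFieldTheory.OSEnvelope
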